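import Literature.NumberTheory.LFunctions.LogFreeDensityZetaLocal
import Literature.NumberTheory.LFunctions.LogFreeDensityLemmaA
import HarnessLib

/-!
# Bombieri's Lemme A for `ζ`

Topic `Literature/NumberTheory/LFunctions`, sub-namespace `LogFreeDensity`. Everything here is
PROVED: the `ζ`-version of `LogFreeDensity.lemmeA_explicit` (Bombieri, *Le grand crible*, §6 Lemme A,
the case `χ = χ₀`), for `F = ζ₁'/ζ₁` with `ζ₁ = (s − 1)ζ` entire, so that the argument of
`LogFreeDensityLemmaA.lean` applies verbatim at every height `v` with the inputs of
`LogFreeDensityZetaLocal.lean` (`exists_sum_near_le_zeta`, `exists_norm_iteratedDeriv_logDeriv_sub_le_zeta`)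
and the Jensen count `exists_sum_zetaDiscZeros_le` of the tree. The pole of `ζ` reappears only on
the Dirichlet-series side (`ζ₁'/ζ₁ = ζ'/ζ + 1/(s − 1)`), in Lemme B.

## References
* [Bombieri1987GrandCrible] §6 Lemme A, pp. 43–45.
-/

noncomputable section

open Complex Metric Set Filter Finset
open scoped Real Topology

namespace Literature.NumberTheory.LFunctions.LogFreeDensity

open Literature.NumberTheory.LFunctions Literature.Analysis.Complex.PowerSum

set_option maxHeartbeats 1600000 in
/-- **Bombieri's LEMME A for `ζ`** (*Le grand crible*, §6, p. 43, the case `χ = χ₀`, with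
`F = ζ₁'/ζ₁`, `ζ₁ = (s − 1)ζ`, loss `e^{-10K}`, free logarithmic scale `L' ≥ log(|v| + 4)`): there is
an absolute `c₄ > 0` such that for `0 < r`, `512 r ≤ 1/8`, `rL' ≥ 1`, a zero `ρ₀` of `ζ` with
`|ρ₀ − (1 + iv)| ≤ r`, and every natural `K ≥ c₄ rL' + 2`, there is `k ∈ [K, 2K]` with
`(1/k!) ‖(ζ₁'/ζ₁)^{(k)}(1 + r + iv)‖ ≥ e^{−10K} (2r)^{−(k+1)}`. [cite: Bombieri1987GrandCrible, §6 Lemme A] -/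
theorem lemmeA_zeta :
    ∃ c₄ : ℝ, 0 < c₄ ∧
      ∀ (v r L' : ℝ), Real.log (|v| + 4) ≤ L' → 0 < r → 512 * r ≤ 1 / 8 → 1 ≤ r * L' →
        (∃ ρ₀ ∈ zetaDiscZeros v, ‖ρ₀ - (1 + (v : ℂ) * I)‖ ≤ r) →
        ∀ K : ℕ, c₄ * (r * L') + 2 ≤ K →
          ∃ k ∈ Finset.Icc K (2 * K),
            Real.exp (-(10 * K)) * (2 * r)⁻¹ ^ (k + 1) ≤
              ‖iteratedDeriv k (logDeriv riemannZeta₁) (((1 + r : ℝ) : ℂ) + (v : ℂ) * I)‖ /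
                k.factorial := by
  obtain ⟨C_d, hC_d, hdens⟩ := exists_sum_near_le_zeta
  obtain ⟨C_J, hC_J, hjensen⟩ := exists_sum_zetaDiscZeros_le
  obtain ⟨C₁, hC₁, hderiv⟩ := exists_norm_iteratedDeriv_logDeriv_sub_le_zeta
  obtain ⟨C₆, hC₆⟩ : ∃ C₆ : ℝ, C₆ = 4 * C_d * (1 + 512) + 2048 * C_J + 256 * C₁ := ⟨_, rfl⟩
  have hC₆pos : 0 < C₆ := by rw [hC₆]; positivity
  refine ⟨7 * C_d * 512 + C₆, by positivity,
    fun v r L' hLL' hr hr8 hu hzero K hK => ?_⟩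
  classical
  obtain ⟨ρ₀, hρ₀, hρ₀r⟩ := hzero
  set ℒ : ℝ := Real.log (|v| + 4) with hℒ
  have hℒ1 : 1 ≤ ℒ := by rw [hℒ]; exact ClassicalZFRData.one_le_log_tau v
  have hℒL' : ℒ ≤ L' := hLL'
  have hL'0 : 0 ≤ L' := by linarith
  set u : ℝ := r * L' with hudef
  have hr0 : r ≤ 1 / 4096 := by linarith
  obtain ⟨lam, hlam⟩ : ∃ lam : ℝ, lam = 512 * r := ⟨_, rfl⟩
  have hlam8 : lam ≤ 1 / 8 := by rw [hlam]; exact hr8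
  have hlampos : 0 < lam := by rw [hlam]; positivity
  set w : ℂ := 1 + (v : ℂ) * I with hw
  set s₀ : ℂ := ((1 + r : ℝ) : ℂ) + (v : ℂ) * I with hs₀
  set D := zetaDiscDivisor v with hD
  set Z := zetaDiscZeros v with hZ
  -- facts about the zeros in the disc
  have hZprop : ∀ ρ ∈ Z, ρ.re < 1 ∧ (1 : ℝ) ≤ D ρ := by
    intro ρ hρ
    have h := zetaDiscZeros_prop hρ
    refine ⟨zeta_re_lt_one_of_mem hρ, ?_⟩
    rw [hD, h.2.2.2.2.1]; exact_mod_cast h.2.2.2.2.2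
  have hDnn : ∀ ρ, (0 : ℝ) ≤ D ρ := fun ρ => by exact_mod_cast zetaDiscDivisor_nonneg v ρ
  have hs₀w : s₀ - w = (r : ℂ) := by rw [hs₀, hw]; push_cast; ring
  have hs₀re : s₀.re = 1 + r := by simp [hs₀]
  have hs₀ρ : ∀ ρ ∈ Z, s₀ - ρ ≠ 0 := by
    intro ρ hρ h0
    have := congr_arg Complex.re h0
    rw [sub_re, hs₀re, zero_re] at this
    linarith [(hZprop ρ hρ).1]
  -- the near zeros
  set NEAR := Z.filter (fun ρ => ‖ρ - w‖ ≤ lam) with hNEAR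
  have hρ₀N : ρ₀ ∈ NEAR := by
    rw [hNEAR, Finset.mem_filter]
    refine ⟨hρ₀, hρ₀r.trans ?_⟩
    rw [hlam]; linarith
  have hNne : NEAR.Nonempty := ⟨ρ₀, hρ₀N⟩
  set n : ℕ := NEAR.card with hn
  have hn1 : 1 ≤ n := Finset.card_pos.2 hNne
  -- `n ≤ ∑_{NEAR} m ≤ C_d (1 + λℒ) ≤ 2 C_d A u`
  have hAu : 1 ≤ 512 * u := by
    have : (1:ℝ) ≤ u := hu; nlinarith
  have hn_le : (n : ℝ) ≤ 2 * C_d * 512 * u := by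
    have h1 : (n : ℝ) ≤ ∑ ρ ∈ NEAR, (D ρ : ℝ) := by
      rw [hn]
      have : ((NEAR.card : ℕ) : ℝ) = ∑ ρ ∈ NEAR, (1 : ℝ) := by simp
      rw [this]
      exact Finset.sum_le_sum fun ρ hρ => (hZprop ρ (Finset.mem_filter.1 hρ).1).2
    have h2 := hdens v lam hlampos (by linarith)
    calc (n : ℝ) ≤ ∑ ρ ∈ NEAR, (D ρ : ℝ) := h1
      _ ≤ C_d * (1 + lam * ℒ) := h2
      _ ≤ C_d * (1 + lam * L') := by gcongr
      _ = C_d * (1 + 512 * u) := by rw [hlam, hudef]; ring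
      _ ≤ C_d * (2 * (512 * u)) := by gcongr; linarith
      _ = 2 * C_d * 512 * u := by ring
  have hKn : (n : ℝ) + 1 ≤ K := by
    have : 2 * C_d * 512 * u ≤ 7 * C_d * 512 * u := by
      have : 0 ≤ C_d * 512 * u := by positivity
      nlinarith
    nlinarith [hK, hC₆pos, (show (0:ℝ) ≤ u by linarith)]
  /- ── Turán's second main theorem on the near zeros ── -/
  obtain ⟨j₀, hj₀N, hj₀max⟩ := Finset.exists_max_image NEAR (fun ρ => ‖(s₀ - ρ)⁻¹‖) hNne
  have hj₀Z : j₀ ∈ Z := (Finset.mem_filter.1 hj₀N).1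
  have hz₀ : (s₀ - j₀)⁻¹ ≠ 0 := inv_ne_zero (hs₀ρ j₀ hj₀Z)
  obtain ⟨ν, hν, hT⟩ := exists_powerSum_ge_max NEAR (fun ρ => (s₀ - ρ)⁻¹) (fun ρ => (D ρ : ℝ))
    (fun ρ _ => hDnn ρ) hj₀N hj₀max hz₀ K
  rw [Finset.mem_Icc, ← hn] at hν
  rw [← hn] at hT
  -- `‖z_{j₀}‖ ≥ 1/(2r)`
  have hzj₀ : (2 * r)⁻¹ ≤ ‖(s₀ - j₀)⁻¹‖ := by
    refine le_trans ?_ (hj₀max ρ₀ hρ₀N)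
    rw [norm_inv]
    have hle : ‖s₀ - ρ₀‖ ≤ 2 * r := by
      calc ‖s₀ - ρ₀‖ = ‖(s₀ - w) + (w - ρ₀)‖ := by ring_nf
        _ ≤ ‖s₀ - w‖ + ‖w - ρ₀‖ := norm_add_le _ _
        _ ≤ r + r := by
            rw [hs₀w, Complex.norm_real, Real.norm_eq_abs, abs_of_pos hr, norm_sub_rev]
            exact add_le_add le_rfl hρ₀r
        _ = 2 * r := by ring
    exact inv_anti₀ (norm_pos_iff.2 (hs₀ρ ρ₀ hρ₀)) hle
  -- the main term: `‖∑_{NEAR} m (s₀−ρ)^{-ν}‖ ≥ e^{-(7n+6+2K)} (2r)^{-ν}`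
  have hmain : Real.exp (-(7 * n + 6 + 2 * K : ℝ)) * (2 * r)⁻¹ ^ ν ≤
      ‖∑ ρ ∈ NEAR, (D ρ : ℂ) / (s₀ - ρ) ^ ν‖ := by
    have hloss := turanLoss_ge hn1 K
    have hb1 : (1 : ℝ) ≤ D j₀ := (hZprop j₀ hj₀Z).2
    have hsum_eq : ∑ ρ ∈ NEAR, (((D ρ : ℝ)) : ℂ) * ((s₀ - ρ)⁻¹) ^ ν =
        ∑ ρ ∈ NEAR, (D ρ : ℂ) / (s₀ - ρ) ^ ν := by
      refine Finset.sum_congr rfl fun ρ _ => ?_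
      simp only [div_eq_mul_inv, inv_pow, Complex.ofReal_intCast]
    rw [← hsum_eq]
    refine le_trans ?_ hT
    have hc0 : 0 ≤ Real.exp (-(n : ℝ)) * ((n : ℝ) / (250 * (K + n))) ^ (n + 1) := by positivity
    have hpow : (2 * r)⁻¹ ^ ν ≤ ‖(s₀ - j₀)⁻¹‖ ^ ν := pow_le_pow_left₀ (by positivity) hzj₀ ν
    calc Real.exp (-(7 * n + 6 + 2 * K : ℝ)) * (2 * r)⁻¹ ^ ν
        ≤ (1 * (Real.exp (-(n : ℝ)) * ((n : ℝ) / (250 * (K + n))) ^ (n + 1))) * (2 * r)⁻¹ ^ ν := by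
          rw [one_mul]; exact mul_le_mul_of_nonneg_right hloss (by positivity)
      _ ≤ ((D j₀ : ℝ) * (Real.exp (-(n : ℝ)) * ((n : ℝ) / (250 * (K + n))) ^ (n + 1))) *
            ‖(s₀ - j₀)⁻¹‖ ^ ν := by
          refine mul_le_mul (mul_le_mul_of_nonneg_right hb1 hc0) hpow (by positivity) ?_
          exact mul_nonneg (by linarith) hc0
  /- ── the error terms at `k = ν − 1` ── -/
  obtain ⟨k, rfl⟩ : ∃ k, ν = k + 1 := ⟨ν - 1, by omega⟩
  refine ⟨k, ?_, ?_⟩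
  · rw [Finset.mem_Icc]
    have : (n : ℝ) + 1 ≤ K := hKn
    have hnK : n + 1 ≤ K := by exact_mod_cast this
    omega
  have hk1 : 1 ≤ k := by
    have : (2 : ℝ) ≤ K := by nlinarith [hK, hC₆pos, (show (0:ℝ) ≤ u by linarith), hC_d]
    have : 2 ≤ K := by exact_mod_cast this
    omega
  -- (E1) Cauchy remainder
  have hs₀mem : s₀ ∈ closedBall (2 + (v : ℂ) * I) (8 / 5) := by
    rw [mem_closedBall, dist_eq_norm]
    have : s₀ - (2 + (v : ℂ) * I) = ((r - 1 : ℝ) : ℂ) := by rw [hs₀]; push_cast; ring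
    rw [this, Complex.norm_real, Real.norm_eq_abs, abs_of_nonpos (by linarith)]
    linarith
  have hs₀1 : s₀ ≠ 1 := by
    intro h; have := congr_arg Complex.re h; rw [hs₀re, one_re] at this; linarith
  have hLs₀ : riemannZeta₁ s₀ ≠ 0 := fun h =>
    riemannZeta_ne_zero_of_one_le_re (by rw [hs₀re]; linarith) ((riemannZeta₁_eq_zero_iff hs₀1).1 h)
  have hE1 := hderiv v s₀ hs₀mem hLs₀ k
  -- (E2)+(E3) the far zeros
  set FAR := Z.filter (fun ρ => lam < ‖ρ - w‖) with hFAR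
  have hsplit : ∑ ρ ∈ Z, (D ρ : ℂ) / (s₀ - ρ) ^ (k + 1) =
      ∑ ρ ∈ NEAR, (D ρ : ℂ) / (s₀ - ρ) ^ (k + 1) + ∑ ρ ∈ FAR, (D ρ : ℂ) / (s₀ - ρ) ^ (k + 1) := by
    rw [hNEAR, hFAR, ← Finset.sum_filter_add_sum_filter_not Z (fun ρ => ‖ρ - w‖ ≤ lam)]
    congr 1
    refine Finset.sum_congr ?_ fun _ _ => rfl
    ext ρ; simp [not_le]
  have hFARbound : ‖∑ ρ ∈ FAR, (D ρ : ℂ) / (s₀ - ρ) ^ (k + 1)‖ ≤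
      4 * C_d * (1 + lam * ℒ) * (2 / lam) ^ (k + 1) + C_J * ℒ * 8 ^ (k + 1) := by
    -- termwise
    have hterm : ∀ ρ ∈ FAR, ‖(D ρ : ℂ) / (s₀ - ρ) ^ (k + 1)‖ ≤
        (if ‖ρ - w‖ ≤ 1 / 4 then (D ρ : ℝ) * (2 / ‖ρ - w‖) ^ (k + 1) else 0) +
          (if 1 / 4 < ‖ρ - w‖ then (D ρ : ℝ) * 8 ^ (k + 1) else 0) := by
      intro ρ hρ
      rw [hFAR, Finset.mem_filter] at hρ
      obtain ⟨hρZ, hρfar⟩ := hρ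
      have hDρ : ‖(D ρ : ℂ)‖ = (D ρ : ℝ) := by
        rw [show ((D ρ : ℤ) : ℂ) = (((D ρ : ℤ) : ℝ) : ℂ) by norm_cast, Complex.norm_real,
          Real.norm_eq_abs, abs_of_nonneg (hDnn ρ)]
      rw [norm_div, norm_pow, hDρ]
      -- `‖s₀ − ρ‖ ≥ ‖ρ − w‖ − r`
      have hdist : ‖ρ - w‖ - r ≤ ‖s₀ - ρ‖ := by
        have : ‖ρ - w‖ ≤ ‖ρ - s₀‖ + ‖s₀ - w‖ := by
          calc ‖ρ - w‖ = ‖(ρ - s₀) + (s₀ - w)‖ := by ring_nf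
            _ ≤ _ := norm_add_le _ _
        rw [hs₀w, Complex.norm_real, Real.norm_eq_abs, abs_of_pos hr, norm_sub_rev ρ s₀] at this
        linarith
      have hρw2r : 2 * r ≤ ‖ρ - w‖ := by
        rw [hlam] at hρfar
        linarith
      have hρwpos : 0 < ‖ρ - w‖ := by linarith
      by_cases hq : ‖ρ - w‖ ≤ 1 / 4
      · rw [if_pos hq, if_neg (not_lt.2 hq), add_zero]
        refine div_le_of_le_mul₀ (by positivity) (mul_nonneg (hDnn ρ) (by positivity)) ?_
        rw [mul_assoc]
        refine le_mul_of_one_le_right (hDnn ρ) ?_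
        rw [div_pow, div_mul_eq_mul_div, le_div_iff₀ (pow_pos hρwpos _), one_mul, ← mul_pow]
        refine pow_le_pow_left₀ (norm_nonneg _) ?_ _
        linarith
      · rw [if_neg hq, if_pos (not_le.1 hq), zero_add]
        refine div_le_of_le_mul₀ (by positivity) (mul_nonneg (hDnn ρ) (by positivity)) ?_
        rw [mul_assoc]
        refine le_mul_of_one_le_right (hDnn ρ) ?_
        rw [← mul_pow]
        refine one_le_pow₀ ?_
        rw [not_le] at hq
        linarith
    refine (norm_sum_le _ _).trans ((Finset.sum_le_sum hterm).trans ?_)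
    rw [Finset.sum_add_distrib, ← Finset.sum_filter, ← Finset.sum_filter]
    refine add_le_add ?_ ?_
    · -- shells
      have hset : FAR.filter (fun ρ => ‖ρ - w‖ ≤ 1 / 4) =
          Z.filter (fun ρ => lam < ‖ρ - w‖ ∧ ‖ρ - w‖ ≤ 1 / 4) := by
        rw [hFAR, Finset.filter_filter]
      rw [hset]
      refine far_shell_sum_le Z (fun ρ => (D ρ : ℝ)) (fun ρ _ => hDnn ρ) w hlampos (by linarith)
        (by linarith) hC_d.le (fun t ht1 ht4 => ?_) hk1
      exact hdens v t (by linarith) ht4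
    · -- beyond `1/4`: Jensen
      calc ∑ ρ ∈ FAR.filter (fun ρ => 1 / 4 < ‖ρ - w‖), (D ρ : ℝ) * 8 ^ (k + 1)
          ≤ ∑ ρ ∈ Z, (D ρ : ℝ) * 8 ^ (k + 1) := by
            refine Finset.sum_le_sum_of_subset_of_nonneg ?_ fun ρ _ _ =>
              mul_nonneg (hDnn ρ) (by positivity)
            exact (Finset.filter_subset _ _).trans (Finset.filter_subset _ _)
        _ = (∑ ρ ∈ Z, (D ρ : ℝ)) * 8 ^ (k + 1) := by rw [Finset.sum_mul]
        _ ≤ C_J * ℒ * 8 ^ (k + 1) :=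
            mul_le_mul_of_nonneg_right (hjensen v) (by positivity)
  /- ── assembling the lower bound ── -/
  have hfacpos : (0 : ℝ) < k.factorial := by exact_mod_cast k.factorial_pos
  -- `‖ID/k! − (−1)^k Σ_Z‖ ≤ 16^k C₁ ℒ`
  have hE1' : ‖iteratedDeriv k (logDeriv riemannZeta₁) s₀ / k.factorial -
      (-1) ^ k * ∑ ρ ∈ Z, (D ρ : ℂ) / (s₀ - ρ) ^ (k + 1)‖ ≤ 16 ^ k * (C₁ * ℒ) := by
    have : iteratedDeriv k (logDeriv riemannZeta₁) s₀ / k.factorial -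
        (-1) ^ k * ∑ ρ ∈ Z, (D ρ : ℂ) / (s₀ - ρ) ^ (k + 1) =
        (k.factorial : ℂ)⁻¹ * (iteratedDeriv k (logDeriv riemannZeta₁) s₀ -
          (-1) ^ k * k.factorial * ∑ ρ ∈ Z, (D ρ : ℂ) / (s₀ - ρ) ^ (k + 1)) := by
      have : (k.factorial : ℂ) ≠ 0 := by exact_mod_cast k.factorial_ne_zero
      field_simp
    rw [this, norm_mul, norm_inv, Complex.norm_natCast, inv_mul_le_iff₀ hfacpos]
    calc _ ≤ (k.factorial : ℝ) * 16 ^ k * (C₁ * ℒ) := hE1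
      _ = _ := by ring
  -- lower bound for `‖ID‖/k!`
  have hlow : Real.exp (-(7 * n + 6 + 2 * K : ℝ)) * (2 * r)⁻¹ ^ (k + 1) -
      (4 * C_d * (1 + lam * ℒ) * (2 / lam) ^ (k + 1) + C_J * ℒ * 8 ^ (k + 1)) - 16 ^ k * (C₁ * ℒ) ≤
      ‖iteratedDeriv k (logDeriv riemannZeta₁) s₀‖ / k.factorial := by
    have h1 : ‖∑ ρ ∈ NEAR, (D ρ : ℂ) / (s₀ - ρ) ^ (k + 1)‖ -
        ‖∑ ρ ∈ FAR, (D ρ : ℂ) / (s₀ - ρ) ^ (k + 1)‖ ≤ ‖∑ ρ ∈ Z, (D ρ : ℂ) / (s₀ - ρ) ^ (k + 1)‖ := by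
      rw [hsplit]
      have := norm_add_le (∑ ρ ∈ NEAR, (D ρ : ℂ) / (s₀ - ρ) ^ (k + 1) + ∑ ρ ∈ FAR, (D ρ : ℂ) / (s₀ - ρ) ^ (k + 1))
        (-(∑ ρ ∈ FAR, (D ρ : ℂ) / (s₀ - ρ) ^ (k + 1)))
      rw [add_neg_cancel_right, norm_neg] at this
      linarith
    have h2 : ‖∑ ρ ∈ Z, (D ρ : ℂ) / (s₀ - ρ) ^ (k + 1)‖ - 16 ^ k * (C₁ * ℒ) ≤
        ‖iteratedDeriv k (logDeriv riemannZeta₁) s₀‖ / k.factorial := by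
      have hn1' : ‖(-1 : ℂ) ^ k * ∑ ρ ∈ Z, (D ρ : ℂ) / (s₀ - ρ) ^ (k + 1)‖ =
          ‖∑ ρ ∈ Z, (D ρ : ℂ) / (s₀ - ρ) ^ (k + 1)‖ := by
        rw [norm_mul, norm_pow, norm_neg, norm_one, one_pow, one_mul]
      have := norm_sub_norm_le ((-1 : ℂ) ^ k * ∑ ρ ∈ Z, (D ρ : ℂ) / (s₀ - ρ) ^ (k + 1))
        (iteratedDeriv k (logDeriv riemannZeta₁) s₀ / k.factorial)
      rw [hn1', norm_sub_rev] at this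
      simp only [norm_div, Complex.norm_natCast] at this ⊢
      linarith
    linarith [hmain, hFARbound]
  refine le_trans ?_ hlow
  /- ── the arithmetic: errors ≤ half the main term, and `e^{-10K} ≤ ½ e^{-(7n+6+2K)}` ── -/
  have hupos : 0 < u := lt_of_lt_of_le one_pos hu
  -- express the errors through `(1/128)^{k+1} (2r)^{-(k+1)} = (1/(256 r))^{k+1}`
  have h128 : ((1 : ℝ) / 128) ^ (k + 1) * (2 * r)⁻¹ ^ (k + 1) = (1 / (256 * r)) ^ (k + 1) := by
    rw [← mul_pow]; congr 1; field_simp; ring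
  have hE2 : 4 * C_d * (1 + lam * ℒ) * (2 / lam) ^ (k + 1) ≤
      4 * C_d * (1 + 512) * u * (((1 : ℝ) / 128) ^ (k + 1) * (2 * r)⁻¹ ^ (k + 1)) := by
    rw [h128]
    have hq : (2 / lam) ^ (k + 1) = (1 / (256 * r)) ^ (k + 1) := by
      congr 1; rw [hlam]; field_simp; norm_num
    rw [hq]
    refine mul_le_mul_of_nonneg_right ?_ (by positivity)
    have h1 : lam * ℒ ≤ 512 * u := by
      rw [hlam, hudef]
      have := mul_le_mul_of_nonneg_left hℒL' (show (0:ℝ) ≤ 512 * r by positivity)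
      linarith
    have h2 : 1 + lam * ℒ ≤ (1 + 512) * u := by
      have : (1:ℝ) ≤ u := hu; linarith
    have hCd4 : (0 : ℝ) ≤ 4 * C_d := by positivity
    calc 4 * C_d * (1 + lam * ℒ) ≤ 4 * C_d * ((1 + 512) * u) :=
          mul_le_mul_of_nonneg_left h2 hCd4
      _ = _ := by ring
  have hE3 : C_J * ℒ * 8 ^ (k + 1) ≤
      2048 * C_J * u * (((1 : ℝ) / 128) ^ (k + 1) * (2 * r)⁻¹ ^ (k + 1)) := by
    rw [h128]
    have h16 : (8 : ℝ) * (256 * r) ≤ 1 := by nlinarith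
    have hrr : (0 : ℝ) < (256 * r) ^ (k + 1) := by positivity
    have key : C_J * ℒ * 8 ^ (k + 1) * (256 * r) ^ (k + 1) ≤ 2048 * C_J * u := by
      calc C_J * ℒ * 8 ^ (k + 1) * (256 * r) ^ (k + 1)
          = C_J * ℒ * (8 * (256 * r)) * (8 ^ k * (256 * r) ^ k) := by rw [pow_succ, pow_succ]; ring
        _ = C_J * ℒ * (8 * (256 * r)) * (8 * (256 * r)) ^ k := by rw [← mul_pow]
        _ ≤ C_J * ℒ * (8 * (256 * r)) * 1 := by
            refine mul_le_mul_of_nonneg_left (pow_le_one₀ (by positivity) h16) (by positivity)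
        _ ≤ C_J * L' * (8 * (256 * r)) * 1 := by gcongr
        _ = 2048 * C_J * u := by rw [hudef]; ring
    have : (1 / (256 * r)) ^ (k + 1) = ((256 * r) ^ (k + 1))⁻¹ := by rw [one_div, inv_pow]
    rw [this, ← div_eq_mul_inv, le_div_iff₀ hrr]
    exact key
  have hE1'' : (16 : ℝ) ^ k * (C₁ * ℒ) ≤
      256 * C₁ * u * (((1 : ℝ) / 128) ^ (k + 1) * (2 * r)⁻¹ ^ (k + 1)) := by
    rw [h128]
    have h32 : (16 : ℝ) * (256 * r) ≤ 1 := by nlinarith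
    have hrr : (0 : ℝ) < (256 * r) ^ (k + 1) := by positivity
    have key : (16 : ℝ) ^ k * (C₁ * ℒ) * (256 * r) ^ (k + 1) ≤ 256 * C₁ * u := by
      calc (16 : ℝ) ^ k * (C₁ * ℒ) * (256 * r) ^ (k + 1)
          = C₁ * (ℒ * (256 * r)) * (16 ^ k * (256 * r) ^ k) := by rw [pow_succ]; ring
        _ = C₁ * (ℒ * (256 * r)) * (16 * (256 * r)) ^ k := by rw [← mul_pow]
        _ ≤ C₁ * (ℒ * (256 * r)) * 1 := by
            refine mul_le_mul_of_nonneg_left (pow_le_one₀ (by positivity) h32) (by positivity)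
        _ ≤ C₁ * (L' * (256 * r)) * 1 := by gcongr
        _ = 256 * C₁ * u := by rw [hudef]; ring
    have : (1 / (256 * r)) ^ (k + 1) = ((256 * r) ^ (k + 1))⁻¹ := by rw [one_div, inv_pow]
    rw [this, ← div_eq_mul_inv, le_div_iff₀ hrr]
    exact key
  have herr : 4 * C_d * (1 + lam * ℒ) * (2 / lam) ^ (k + 1) + C_J * ℒ * 8 ^ (k + 1) +
      16 ^ k * (C₁ * ℒ) ≤ C₆ * u * (((1 : ℝ) / 128) ^ (k + 1) * (2 * r)⁻¹ ^ (k + 1)) := by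
    have : C₆ * u * (((1 : ℝ) / 128) ^ (k + 1) * (2 * r)⁻¹ ^ (k + 1)) =
        4 * C_d * (1 + 512) * u * (((1 : ℝ) / 128) ^ (k + 1) * (2 * r)⁻¹ ^ (k + 1)) +
          2048 * C_J * u * (((1 : ℝ) / 128) ^ (k + 1) * (2 * r)⁻¹ ^ (k + 1)) +
          256 * C₁ * u * (((1 : ℝ) / 128) ^ (k + 1) * (2 * r)⁻¹ ^ (k + 1)) := by
      rw [hC₆]; ring
    rw [this]; linarith
  -- `(1/128)^{k+1} ≤ e^{-4(K+1)}`
  have hpow128 : ((1 : ℝ) / 128) ^ (k + 1) ≤ Real.exp (-(4 * (K + 1 : ℝ))) := by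
    calc ((1 : ℝ) / 128) ^ (k + 1) ≤ (Real.exp (-4)) ^ (k + 1) :=
          pow_le_pow_left₀ (by norm_num) inv_128_le_exp_neg_four _
      _ = Real.exp (-(4 * (k + 1 : ℝ))) := by rw [← Real.exp_nat_mul]; push_cast; ring_nf
      _ ≤ Real.exp (-(4 * (K + 1 : ℝ))) := by
          refine Real.exp_le_exp.2 ?_
          have : (K : ℝ) ≤ k := by exact_mod_cast (show K ≤ k by omega)
          linarith
  -- `C₆ u e^{-4(K+1)} ≤ ½ e^{-(7n+6+2K)}`
  have hKey : C₆ * u * Real.exp (-(4 * (K + 1 : ℝ))) ≤ Real.exp (-(7 * n + 6 + 2 * K : ℝ)) / 2 := by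
    have hexp : 2 * C₆ * u ≤ Real.exp (2 * K - 7 * n - 2 : ℝ) := by
      have h1 : 2 * C₆ * u + 1 ≤ Real.exp (2 * C₆ * u) := Real.add_one_le_exp _
      have h2 : 2 * C₆ * u ≤ 2 * K - 7 * n - 2 := by
        have hK' : (7 * C_d * 512 + C₆) * u + 2 ≤ K := hK
        nlinarith [hn_le, hC_d, hupos]
      linarith [Real.exp_le_exp.2 h2]
    have hsplit2 : Real.exp (-(7 * n + 6 + 2 * K : ℝ)) =
        Real.exp (2 * K - 7 * n - 2 : ℝ) * Real.exp (-(4 * (K + 1 : ℝ))) := by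
      rw [← Real.exp_add]; ring_nf
    rw [hsplit2, le_div_iff₀ (by norm_num : (0:ℝ) < 2)]
    have hpos2 : (0 : ℝ) < Real.exp (-(4 * (K + 1 : ℝ))) := Real.exp_pos _
    nlinarith
  -- `e^{-10K} ≤ ½ e^{-(7n+6+2K)}`
  have hfinal : Real.exp (-(10 * K : ℝ)) ≤ Real.exp (-(7 * n + 6 + 2 * K : ℝ)) / 2 := by
    rw [le_div_iff₀ (by norm_num : (0:ℝ) < 2)]
    have h2 : (2 : ℝ) ≤ Real.exp 1 := by have := Real.exp_one_gt_d9; linarith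
    have hKn' : (n : ℝ) + 1 ≤ K := hKn
    calc Real.exp (-(10 * K : ℝ)) * 2 ≤ Real.exp (-(10 * K : ℝ)) * Real.exp 1 :=
          mul_le_mul_of_nonneg_left h2 (Real.exp_pos _).le
      _ = Real.exp (-(10 * K : ℝ) + 1) := by rw [Real.exp_add]
      _ ≤ Real.exp (-(7 * n + 6 + 2 * K : ℝ)) := Real.exp_le_exp.2 (by nlinarith)
  -- conclude with `X = (2r)^{-(k+1)}`, `M = e^{-(7n+6+2K)}` generalised
  have hXpos : (0 : ℝ) < (2 * r)⁻¹ ^ (k + 1) := by positivity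
  generalize hX : (2 * r)⁻¹ ^ (k + 1) = X at hXpos herr ⊢
  generalize hM : Real.exp (-(7 * n + 6 + 2 * K : ℝ)) = M at hKey hfinal ⊢
  have herr' : 4 * C_d * (1 + lam * ℒ) * (2 / lam) ^ (k + 1) + C_J * ℒ * 8 ^ (k + 1) +
      16 ^ k * (C₁ * ℒ) ≤ M / 2 * X := by
    refine herr.trans ?_
    calc C₆ * u * ((1 / 128) ^ (k + 1) * X) = (C₆ * u * (1 / 128) ^ (k + 1)) * X := by ring
      _ ≤ (C₆ * u * Real.exp (-(4 * (K + 1 : ℝ)))) * X := by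
          refine mul_le_mul_of_nonneg_right ?_ hXpos.le
          exact mul_le_mul_of_nonneg_left hpow128 (by positivity)
      _ ≤ M / 2 * X := mul_le_mul_of_nonneg_right hKey hXpos.le
  have hgoal : Real.exp (-(10 * K : ℝ)) * X ≤ M / 2 * X := mul_le_mul_of_nonneg_right hfinal hXpos.le
  have h10 : Real.exp (-(10 * (K : ℝ))) = Real.exp (-(10 * K : ℝ)) := by ring_nf
  rw [h10]
  linarith


end Literature.NumberTheory.LFunctions.LogFreeDensity
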